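import Summits.QuantumFields.YangMills.Theorems.ColdStartUniversalityLatticeLangevinBlockLoopCarre
import Summits.QuantumFields.YangMills.Theorems.ColdStartUniversalityLatticeLangevinMacroscopicMixingOfLogSobolev
import HarnessLib

/-!
# Route `ColdStartUniversality` (fixed-cut-off package): BLOCK-AVERAGED (local) Wilson loops — cold-start equilibration with a prefactor
# `√(number of blocks)`, at `|β'| < 1/12` and from a HYPOTHESIS log-Sobolev inequality

Helper file (seat `ym-line-csu-p1`, g28; `--supports stmt-QuantumFields-24809`).  For a nonempty set `B` of base points and the block average
`W̄_B = (#B)⁻¹ Σ_(x∈B) W_(R×T)(x; i, j)` of the `SU(2)` Wilson loop (the crux's observables are UNIT-BLOCK averages), the sparsity-aware carré bound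
`Γ(W̄_B) ≤ 32(R+T)²/#B` (`…BlockLoopCarre`) and the transport–entropy mixing bounds give:
* `blockLoopAverage_coords_eq` — the block-averaged loop functional (`c = 1/(2#B)`) reads `W̄_B`;
* ★★★ `wilson_coldStart_blockLoop_le_exp_explicit` / `…_le_blocks` (`|β'| < 1/12`, `ρ = 1 − 12|β'|`):
  `|E W̄_B(U_(2+u)) − ∫W̄_B dμ_(β')| ≤ 33(R+T)·√(L³/#B)·e^(−ρu)/√ρ` — prefactor = √(NUMBER OF BLOCKS);
* ★★ `wilson_coldStart_blockLoop_le_exp_of_logSobolev` / `…_le_blocks_of_logSobolev` (every `β'`, hypothesis log-Sobolev(`ρ`)):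
  `≤ e^(−2ρu)(R+T)√(16(366|β'|+3)(L³/#B)/ρ)`.
Reading: torus average (`#B = L³`) — volume-free (g28 `…MacroscopicMixing`); a FIXED block — `O(√L³)`, i.e. a `(3/2)log L/ρ` equilibration time
(local observables are not reached volume-uniformly by the global transport–entropy inequality; that needs a local tool, e.g. the `L^∞`-gradient
bound of memo-g27 §3); the crux's regime — unit PHYSICAL blocks `#B_K = ε_K⁻³` in a fixed physical volume, `L_K³/#B_K = ℓ³` FIXED — the prefactor
is K-independent apart from `β'_K` and `R+T` (`≍ ε_K⁻¹` for physical loops): under (ULS) the threshold is again `O(log(1/ε_K))`.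
HONEST FRAMING: FIXED cut-off; log-Sobolev(`ρ`) is a HYPOTHESIS in the `…_of_logSobolev` statements; nothing K-uniform; 24809 ASIDE not restated;
no crux, rung or summit statement is proved; the Yang–Mills mass gap is NOT proved.  THEOREMS ONLY, no definition, no sorry.
-/

set_option autoImplicit false

noncomputable section

namespace Summit.QuantumFields.YangMills.Theorems.ColdStartUniversality

open MeasureTheory ProbabilityTheory Matrix Complex Finset Filter Set InformationTheory
open scoped ComplexConjugate BigOperators NNReal ENNReal Topology Matrix
open Literature.Probability.Process Literature.MathematicalPhysics.QuantumFieldTheory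
open Literature.MathematicalPhysics.QuantumLattice (fundamentalRep fundamentalLatticeRep continuous_fundamentalRep fundamentalRep_apply)

variable {L : ℕ} [NeZero L]

/-! ## §1. The block-averaged loop functional reads the block average of the Wilson loop -/

omit [NeZero L] in
/-- **The block-averaged loop functional is the block average of the Wilson loop**: with `c = 1/(2·#B)`,
`(c·Σ_(x∈B) Re tr w(ℓ+x))(coords V) = (#B)⁻¹ Σ_(x∈B) W_(R×T)(x; i, j)(V)` (`B` nonempty). [folklore] -/
theorem blockLoopAverage_coords_eq (V : (GaugeConfig 3 L (Matrix.specialUnitaryGroup (Fin 2) ℂ))) (i j : Fin 3) (R T : ℕ) (B : Finset (Site 3 L)) (hB : B.Nonempty) :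
    (fun y : (Edge 3 L × Fin 2 × Fin 2 × Bool → ℝ) => (2 * (B.card : ℝ))⁻¹ * ∑ x ∈ B, ((((((List.range R).map (fun m : ℕ => ((Pi.single i ((m : ℕ) : ZMod L) : Site 3 L), i, false)) ++ (List.range T).map (fun m : ℕ => ((Pi.single i ((R : ℕ) : ZMod L) : Site 3 L) + (Pi.single j ((m : ℕ) : ZMod L) : Site 3 L), j, false)) ++ ((List.range R).map (fun m : ℕ => ((Pi.single j ((T : ℕ) : ZMod L) : Site 3 L) + (Pi.single i ((m : ℕ) : ZMod L) : Site 3 L), i, true))).reverse ++ ((List.range T).map (fun m : ℕ => ((Pi.single j ((m : ℕ) : ZMod L) : Site 3 L), j, true))).reverse).map (fun q : Site 3 L × Fin 3 × Bool => ((x + q.1, q.2.1), q.2.2))).map (fun a : Edge 3 L × Bool => if a.2 then ((fun (ee : Edge 3 L) => Matrix.of fun (i j : Fin 2) => ((y (ee, i, j, false) : ℝ) : ℂ) + ((y (ee, i, j, true) : ℝ) : ℂ) * Complex.I) a.1)ᴴ else (fun (ee : Edge 3 L) => Matrix.of fun (i j : Fin 2) => ((y (ee, i, j, false) : ℝ)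 : ℂ) + ((y (ee, i, j, true) : ℝ) : ℂ) * Complex.I) a.1)).prod)).trace.re) ((fun (V : GaugeConfig 3 L (Matrix.specialUnitaryGroup (Fin 2) ℂ)) (q : Edge 3 L × Fin 2 × Fin 2 × Bool) => (fun z : ℂ => if q.2.2.2 then z.im else z.re) ((fundamentalRep (Fin 2) (V q.1) : Matrix (Fin 2) (Fin 2) ℂ) q.2.1 q.2.2.1)) V) = (((B.card : ℝ))⁻¹ * ∑ x ∈ B, wilsonLoop (fundamentalRep (Fin 2)) x i j R T V) := by
  classical
  have hrebQ : (fun (ee : Edge 3 L) => Matrix.of fun (i j : Fin 2) => ((((fun (V : GaugeConfig 3 L (Matrix.specialUnitaryGroup (Fin 2) ℂ)) (q : Edge 3 L × Fin 2 × Fin 2 × Bool) => (fun z : ℂ => if q.2.2.2 then z.im else z.re) ((fundamentalRep (Fin 2) (V q.1) : Matrix (Fin 2) (Fin 2) ℂ) q.2.1 q.2.2.1)) V) (ee, i, j, false) : ℝ) : ℂ) + ((((fun (V : GaugeConfig 3 L (Matrix.specialUnitaryGroup (Fin 2) ℂ)) (q : Edge 3 L × Fin 2 × Fin 2 × Bool)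 => (fun z : ℂ => if q.2.2.2 then z.im else z.re) ((fundamentalRep (Fin 2) (V q.1) : Matrix (Fin 2) (Fin 2) ℂ) q.2.1 q.2.2.1)) V) (ee, i, j, true) : ℝ) : ℂ) * Complex.I) = matrixConfig (fundamentalRep (Fin 2)) V := by
    funext e
    exact (congrFun (rebuild_coords_of V) e).trans (Matrix.ext fun a b => rfl)
  have hS : (0 : ℝ) < (B.card : ℝ) := by exact_mod_cast hB.card_pos
  show (2 * (B.card : ℝ))⁻¹ * ∑ x ∈ B, ((((((List.range R).map (fun m : ℕ => ((Pi.single i ((m : ℕ) : ZMod L) : Site 3 L), i, false)) ++ (List.range T).map (fun m : ℕ => ((Pi.single i ((R : ℕ) : ZMod L) : Site 3 L) + (Pi.single j ((m : ℕ) : ZMod L) : Site 3 L), j, false)) ++ ((List.range R).map (fun m : ℕ => ((Pi.single j ((T : ℕ) : ZMod L) : Site 3 L) + (Pi.single i ((m : ℕ) : ZMod L) : Site 3 L), i, true))).reverse ++ ((List.range T).map (fun m : ℕ => ((Pi.single j ((m : ℕ) : ZMod L) : Site 3 L), j, true))).reverse).map (fun q : Site 3 L × Fin 3 × Bool => ((x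 + q.1, q.2.1), q.2.2))).map (fun a : Edge 3 L × Bool => if a.2 then ((fun (ee : Edge 3 L) => Matrix.of fun (i j : Fin 2) => ((((fun (V : GaugeConfig 3 L (Matrix.specialUnitaryGroup (Fin 2) ℂ)) (q : Edge 3 L × Fin 2 × Fin 2 × Bool) => (fun z : ℂ => if q.2.2.2 then z.im else z.re) ((fundamentalRep (Fin 2) (V q.1) : Matrix (Fin 2) (Fin 2) ℂ) q.2.1 q.2.2.1)) V) (ee, i, j, false) : ℝ) : ℂ) + ((((fun (V : GaugeConfig 3 L (Matrix.specialUnitaryGroup (Fin 2) ℂ)) (q : Edge 3 L × Fin 2 × Fin 2 × Bool) => (fun z : ℂ => if q.2.2.2 then z.im else z.re) ((fundamentalRep (Fin 2) (V q.1) : Matrix (Fin 2) (Fin 2) ℂ) q.2.1 q.2.2.1)) V) (ee, i, j, true) : ℝ) : ℂ) * Complex.I) a.1)ᴴ else (fun (ee : Edge 3 L) => Matrix.of fun (i j : Fin 2) => ((((fun (V : GaugeConfig 3 L (Matrix.specialUnitaryGroup (Fin 2) ℂ)) (q : Edge 3 L × Fin 2 × Fin 2 × Bool) => (fun z : ℂ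 => if q.2.2.2 then z.im else z.re) ((fundamentalRep (Fin 2) (V q.1) : Matrix (Fin 2) (Fin 2) ℂ) q.2.1 q.2.2.1)) V) (ee, i, j, false) : ℝ) : ℂ) + ((((fun (V : GaugeConfig 3 L (Matrix.specialUnitaryGroup (Fin 2) ℂ)) (q : Edge 3 L × Fin 2 × Fin 2 × Bool) => (fun z : ℂ => if q.2.2.2 then z.im else z.re) ((fundamentalRep (Fin 2) (V q.1) : Matrix (Fin 2) (Fin 2) ℂ) q.2.1 q.2.2.1)) V) (ee, i, j, true) : ℝ) : ℂ) * Complex.I) a.1)).prod)).trace.re = (((B.card : ℝ))⁻¹ * ∑ x ∈ B, wilsonLoop (fundamentalRep (Fin 2)) x i j R T V)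
  rw [hrebQ, Finset.mul_sum, Finset.mul_sum]
  refine Finset.sum_congr rfl fun x _ => ?_
  rw [wilsonLoop, fundamentalRep_rectangleHolonomy V x i j R T]
  push_cast
  field_simp

/-! ## §2. Cold-start equilibration of block averages -/

/-- ★★★ **Cold-start equilibration of a BLOCK-averaged `R × T` Wilson loop, explicit** (`|β'| < 1/12`, `R + T > 0`, `B` a nonempty set of base
points, `W̄_B = (#B)⁻¹ Σ_(x∈B) W_(R×T)(x; i, j)`): for every deterministic start, every solution and every `u ≥ 0`,
`|E W̄_B(U_(2+u)) − ∫ W̄_B dμ_(β')| ≤ e^(−(1−12|β'|)u) · √(32(R+T)²·(366|β'|L³ + 3 log(3/2) L³ + log 2)/(#B·(1 − 12|β'|)))` — the prefactor is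
`O((R+T)√(L³/#B))`, the square root of the NUMBER OF BLOCKS. [cite: ShenZhuZhu2022, §4 Theorem 4.2, Corollary 4.4] -/
theorem wilson_coldStart_blockLoop_le_exp_explicit (L : ℕ) [NeZero L] (β' : ℝ) (hβ : |β'| < 1 / 12) (i j : Fin 3) (R T : ℕ) (hRT : 0 < R + T)
    (B : Finset (Site 3 L)) (hB : B.Nonempty) (z : (GaugeConfig 3 L (Matrix.specialUnitaryGroup (Fin 2) ℂ)))
    {Ω : Type} [MeasurableSpace Ω] {P : Measure Ω} [IsProbabilityMeasure P]
    {W : ℝ≥0 → Ω → (Edge 3 L × NoiseIdx 2 → ℝ)} (hW : IsFlatBrownian W P)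
    {U : ℝ≥0 → Ω → (GaugeConfig 3 L (Matrix.specialUnitaryGroup (Fin 2) ℂ))} (hU0 : ∀ ω, U 0 ω = z)
    (hU : (latticeLangevinDynamics (fundamentalLatticeRep 2) β').IsSolution (fundamentalRep (Fin 2)) hW.natFiltration P W U)
    (u : ℝ≥0) :
    |(∫ ω, (((B.card : ℝ))⁻¹ * ∑ x ∈ B, wilsonLoop (fundamentalRep (Fin 2)) x i j R T (U ((2 : ℝ≥0) + u) ω)) ∂P) - ∫ V, (((B.card : ℝ))⁻¹ * ∑ x ∈ B, wilsonLoop (fundamentalRep (Fin 2)) x i j R T V) ∂(wilsonMeasure (d := 3) (L := L) (fundamentalRep (Fin 2)) β')| ≤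
      Real.exp (-(1 - 12 * |β'|) * u) * Real.sqrt (32 * ((R : ℝ) + T) ^ 2 * (366 * |β'| * (L : ℝ) ^ 3 + 3 * Real.log (3 / 2) * (L : ℝ) ^ 3 + Real.log 2) / ((B.card : ℝ) * (1 - 12 * |β'|))) := by
  classical
  haveI := secondCountableTopology_su2
  haveI := borelSpace_config L
  set μ : Measure (GaugeConfig 3 L (Matrix.specialUnitaryGroup (Fin 2) ℂ)) := (wilsonMeasure (d := 3) (L := L) (fundamentalRep (Fin 2)) β') with hμ
  haveI : IsProbabilityMeasure μ :=
    isProbabilityMeasure_wilsonMeasure (d := 3) (L := L) (fundamentalRep (Fin 2)) (continuous_fundamentalRep (Fin 2)) β'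
  have hdivpos : 0 < (1 - 12 * |β'|) := by linarith
  have hS : (0 : ℝ) < (B.card : ℝ) := by exact_mod_cast hB.card_pos
  have hRT' : (0 : ℝ) < (R : ℝ) + T := by exact_mod_cast hRT
  set co : (GaugeConfig 3 L (Matrix.specialUnitaryGroup (Fin 2) ℂ)) → (Edge 3 L × Fin 2 × Fin 2 × Bool → ℝ) := (fun (V : GaugeConfig 3 L (Matrix.specialUnitaryGroup (Fin 2) ℂ)) (q : Edge 3 L × Fin 2 × Fin 2 × Bool) => (fun z : ℂ => if q.2.2.2 then z.im else z.re) ((fundamentalRep (Fin 2) (V q.1) : Matrix (Fin 2) (Fin 2) ℂ) q.2.1 q.2.2.1)) with hco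
  set fp : (Edge 3 L × Fin 2 × Fin 2 × Bool → ℝ) → ℝ := (fun y : (Edge 3 L × Fin 2 × Fin 2 × Bool → ℝ) => (2 * (B.card : ℝ))⁻¹ * ∑ x ∈ B, ((((((List.range R).map (fun m : ℕ => ((Pi.single i ((m : ℕ) : ZMod L) : Site 3 L), i, false)) ++ (List.range T).map (fun m : ℕ => ((Pi.single i ((R : ℕ) : ZMod L) : Site 3 L) + (Pi.single j ((m : ℕ) : ZMod L) : Site 3 L), j, false)) ++ ((List.range R).map (fun m : ℕ => ((Pi.single j ((T : ℕ) : ZMod L) : Site 3 L) + (Pi.single i ((m : ℕ) : ZMod L) : Site 3 L), i, true))).reverse ++ ((List.range T).map (fun m : ℕ => ((Pi.single j ((m : ℕ) : ZMod L) : Site 3 L), j, true))).reverse).map (fun q : Site 3 L × Fin 3 × Bool => ((x + q.1, q.2.1), q.2.2))).map (fun a : Edge 3 L × Bool => if a.2 then ((fun (ee : Edge 3 L) => Matrix.of fun (i j : Fin 2) => ((y (ee, i, j, false) : ℝ) : ℂ) + ((y (ee, i, j, true) : ℝ) : ℂ) * Complex.I) a.1)ᴴ else (fun (ee : Edge 3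 L) => Matrix.of fun (i j : Fin 2) => ((y (ee, i, j, false) : ℝ) : ℂ) + ((y (ee, i, j, true) : ℝ) : ℂ) * Complex.I) a.1)).prod)).trace.re) with hfp
  have hfpC : ContDiff ℝ 3 fp := contDiff_blockLoopAverage _ _ B
  have hval : ∀ VV : (GaugeConfig 3 L (Matrix.specialUnitaryGroup (Fin 2) ℂ)), fp (co VV) = (((B.card : ℝ))⁻¹ * ∑ x ∈ B, wilsonLoop (fundamentalRep (Fin 2)) x i j R T VV) := fun VV => blockLoopAverage_coords_eq VV i j R T B hB
  have hlen : (((((List.range R).map (fun m : ℕ => ((Pi.single i ((m : ℕ) : ZMod L) : Site 3 L), i, false)) ++ (List.range T).map (fun m : ℕ => ((Pi.single i ((R : ℕ) : ZMod L) : Site 3 L) + (Pi.single j ((m : ℕ) : ZMod L) : Site 3 L), j, false)) ++ ((List.range R).map (fun m : ℕ => ((Pi.single j ((T : ℕ) : ZMod L) : Site 3 L) + (Pi.single i ((m : ℕ) : ZMod L) : Site 3 L), i, true))).reverse ++ ((List.range T).map (fun m : ℕ => ((Pi.single j ((m : ℕ) : ZMod L) : Site 3 L), j, true))).reverse)).length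 : ℕ) : ℝ) = 2 * ((R : ℝ) + T) := by rw [rectShape_length]; push_cast; ring
  have hs : 0 < 32 * ((2 * (B.card : ℝ))⁻¹) ^ 2 * (((((List.range R).map (fun m : ℕ => ((Pi.single i ((m : ℕ) : ZMod L) : Site 3 L), i, false)) ++ (List.range T).map (fun m : ℕ => ((Pi.single i ((R : ℕ) : ZMod L) : Site 3 L) + (Pi.single j ((m : ℕ) : ZMod L) : Site 3 L), j, false)) ++ ((List.range R).map (fun m : ℕ => ((Pi.single j ((T : ℕ) : ZMod L) : Site 3 L) + (Pi.single i ((m : ℕ) : ZMod L) : Site 3 L), i, true))).reverse ++ ((List.range T).map (fun m : ℕ => ((Pi.single j ((m : ℕ) : ZMod L) : Site 3 L), j, true))).reverse)).length : ℕ) : ℝ) ^ 2 * (B.card : ℝ) := by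
    have h2B : 0 < ((2 * (B.card : ℝ))⁻¹) ^ 2 := pow_pos (inv_pos.2 (mul_pos two_pos hS)) 2
    rw [hlen]
    exact mul_pos (mul_pos (mul_pos (by norm_num) h2B) (by positivity)) hS
  have hmain : |(∫ ω, fp (co (U ((2 : ℝ≥0) + u) ω)) ∂P) - ∫ V, fp (co V) ∂μ| ≤
      Real.exp (-(1 - 12 * |β'|) * u) * Real.sqrt ((32 * ((2 * (B.card : ℝ))⁻¹) ^ 2 * (((((List.range R).map (fun m : ℕ => ((Pi.single i ((m : ℕ) : ZMod L) : Site 3 L), i, false)) ++ (List.range T).map (fun m : ℕ => ((Pi.single i ((R : ℕ) : ZMod L) : Site 3 L) + (Pi.single j ((m : ℕ) : ZMod L) : Site 3 L), j, false)) ++ ((List.range R).map (fun m : ℕ => ((Pi.single j ((T : ℕ) : ZMod L) : Site 3 L) + (Pi.single i ((m : ℕ) : ZMod L) : Site 3 L), i, true))).reverse ++ ((List.range T).map (fun m : ℕ => ((Pi.single j ((m : ℕ) : ZMod L) : Site 3 L), j, true))).reverse)).length : ℕ) : ℝ) ^ 2 * (B.card : ℝ)) * (366 * |β'| * (L : ℝ)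 ^ 3 + 3 * Real.log (3 / 2) * (L : ℝ) ^ 3 + Real.log 2) / (1 - 12 * |β'|)) :=
    wilson_coldStart_smooth_le_exp_explicit L β' hβ fp hfpC hs hW z hU0 hU u (wilson_blockLoopAverage_carre_le L β' _ _ B)
  have hEP : ∫ ω, fp (co (U ((2 : ℝ≥0) + u) ω)) ∂P = ∫ ω, (((B.card : ℝ))⁻¹ * ∑ x ∈ B, wilsonLoop (fundamentalRep (Fin 2)) x i j R T (U ((2 : ℝ≥0) + u) ω)) ∂P :=
    integral_congr_ae (ae_of_all _ fun ω => by beta_reduce; rw [hval])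
  have hEμ : ∫ V, fp (co V) ∂μ = ∫ V, (((B.card : ℝ))⁻¹ * ∑ x ∈ B, wilsonLoop (fundamentalRep (Fin 2)) x i j R T V) ∂μ :=
    integral_congr_ae (ae_of_all _ fun V => by beta_reduce; rw [hval])
  have hS0 : (B.card : ℝ) ≠ 0 := hS.ne'
  have e2 : (32 * ((2 * (B.card : ℝ))⁻¹) ^ 2 * (((((List.range R).map (fun m : ℕ => ((Pi.single i ((m : ℕ) : ZMod L) : Site 3 L), i, false)) ++ (List.range T).map (fun m : ℕ => ((Pi.single i ((R : ℕ) : ZMod L) : Site 3 L) + (Pi.single j ((m : ℕ) : ZMod L) : Site 3 L), j, false)) ++ ((List.range R).map (fun m : ℕ => ((Pi.single j ((T : ℕ) : ZMod L) : Site 3 L) + (Pi.single i ((m : ℕ) : ZMod L) : Site 3 L), i, true))).reverse ++ ((List.range T).map (fun m : ℕ => ((Pi.single j ((m : ℕ) : ZMod L) : Site 3 L), j, true))).reverse)).length : ℕ) : ℝ) ^ 2 * (B.card : ℝ)) * (366 * |β'| * (L : ℝ) ^ 3 + 3 * Real.log (3 / 2) * (L : ℝ) ^ 3 + Real.log 2)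 / (1 - 12 * |β'|) =
      32 * ((R : ℝ) + T) ^ 2 * (366 * |β'| * (L : ℝ) ^ 3 + 3 * Real.log (3 / 2) * (L : ℝ) ^ 3 + Real.log 2) / ((B.card : ℝ) * (1 - 12 * |β'|)) := by
    rw [hlen]
    field_simp
  rw [hEP, hEμ, e2] at hmain
  exact hmain

/-- ★★★ **VOLUME/BLOCK form** (`|β'| < 1/12`, `ρ = 1 − 12|β'|`): `|E W̄_B(U_(2+u)) − ∫ W̄_B dμ_(β')| ≤ 33·(R+T)·√(L³/#B)·e^(−ρu)/√ρ` — for a block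
average the prefactor is the square root of the NUMBER OF BLOCKS `L³/#B` (torus average: `#B = L³`, constant `33`; a fixed block: `O(√(L³))`, i.e. an
equilibration time `(3/2)log L/ρ + O(1)` — local observables do not mix volume-uniformly by this route). [cite: ShenZhuZhu2022, §4 Theorem 4.2, Corollary 4.4] -/
theorem wilson_coldStart_blockLoop_le_blocks (L : ℕ) [NeZero L] (β' : ℝ) (hβ : |β'| < 1 / 12) (i j : Fin 3) (R T : ℕ) (hRT : 0 < R + T)
    (B : Finset (Site 3 L)) (hB : B.Nonempty) (z : (GaugeConfig 3 L (Matrix.specialUnitaryGroup (Fin 2) ℂ)))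
    {Ω : Type} [MeasurableSpace Ω] {P : Measure Ω} [IsProbabilityMeasure P]
    {W : ℝ≥0 → Ω → (Edge 3 L × NoiseIdx 2 → ℝ)} (hW : IsFlatBrownian W P)
    {U : ℝ≥0 → Ω → (GaugeConfig 3 L (Matrix.specialUnitaryGroup (Fin 2) ℂ))} (hU0 : ∀ ω, U 0 ω = z)
    (hU : (latticeLangevinDynamics (fundamentalLatticeRep 2) β').IsSolution (fundamentalRep (Fin 2)) hW.natFiltration P W U)
    (u : ℝ≥0) :
    |(∫ ω, (((B.card : ℝ))⁻¹ * ∑ x ∈ B, wilsonLoop (fundamentalRep (Fin 2)) x i j R T (U ((2 : ℝ≥0) + u) ω)) ∂P) - ∫ V, (((B.card : ℝ))⁻¹ * ∑ x ∈ B, wilsonLoop (fundamentalRep (Fin 2)) x i j R T V) ∂(wilsonMeasure (d := 3) (L := L) (fundamentalRep (Fin 2)) β')| ≤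
      33 * ((R : ℝ) + T) * Real.sqrt ((L : ℝ) ^ 3 / (B.card : ℝ)) * Real.exp (-(1 - 12 * |β'|) * u) / Real.sqrt (1 - 12 * |β'|) := by
  have hρ : 0 < 1 - 12 * |β'| := by linarith
  have hRT' : (0 : ℝ) < (R : ℝ) + T := by exact_mod_cast hRT
  have hS : (0 : ℝ) < (B.card : ℝ) := by exact_mod_cast hB.card_pos
  have h := wilson_coldStart_blockLoop_le_exp_explicit L β' hβ i j R T hRT B hB z hW hU0 hU u
  refine h.trans ?_
  have hL30 : (0 : ℝ) < (L : ℝ) ^ 3 := by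
    have hL : 0 < L := Nat.pos_of_ne_zero (NeZero.ne L)
    positivity
  have hB33 := burnInBudget_le_volume L β' hβ
  have hq : 32 * ((R : ℝ) + T) ^ 2 * (366 * |β'| * (L : ℝ) ^ 3 + 3 * Real.log (3 / 2) * (L : ℝ) ^ 3 + Real.log 2) / ((B.card : ℝ) * (1 - 12 * |β'|)) ≤ (33 * ((R : ℝ) + T) * Real.sqrt ((L : ℝ) ^ 3 / (B.card : ℝ)) / Real.sqrt (1 - 12 * |β'|)) ^ 2 := by
    rw [div_pow, Real.sq_sqrt hρ.le, mul_pow, Real.sq_sqrt (by positivity), div_le_div_iff₀ (mul_pos hS hρ) hρ]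
    have hS0 : (B.card : ℝ) ≠ 0 := hS.ne'
    have hRT2 : 0 < ((R : ℝ) + T) ^ 2 := by positivity
    have e : (33 * ((R : ℝ) + T)) ^ 2 * ((L : ℝ) ^ 3 / (B.card : ℝ)) * ((B.card : ℝ) * (1 - 12 * |β'|)) = 1089 * ((R : ℝ) + T) ^ 2 * (L : ℝ) ^ 3 * (1 - 12 * |β'|) := by
      field_simp
      ring
    rw [e]
    nlinarith [mul_le_mul_of_nonneg_left hB33 (le_of_lt (mul_pos hRT2 hρ)), mul_pos (mul_pos hRT2 hρ) hL30]
  have hsq : Real.sqrt (32 * ((R : ℝ) + T) ^ 2 * (366 * |β'| * (L : ℝ) ^ 3 + 3 * Real.log (3 / 2) * (L : ℝ) ^ 3 + Real.log 2) / ((B.card : ℝ) * (1 - 12 * |β'|))) ≤ 33 * ((R : ℝ) + T) * Real.sqrt ((L : ℝ) ^ 3 / (B.card : ℝ)) / Real.sqrt (1 - 12 * |β'|) :=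
    (Real.sqrt_le_sqrt hq).trans (le_of_eq (Real.sqrt_sq (by positivity)))
  calc Real.exp (-(1 - 12 * |β'|) * u) * Real.sqrt (32 * ((R : ℝ) + T) ^ 2 * (366 * |β'| * (L : ℝ) ^ 3 + 3 * Real.log (3 / 2) * (L : ℝ) ^ 3 + Real.log 2) / ((B.card : ℝ) * (1 - 12 * |β'|)))
      ≤ Real.exp (-(1 - 12 * |β'|) * u) * (33 * ((R : ℝ) + T) * Real.sqrt ((L : ℝ) ^ 3 / (B.card : ℝ)) / Real.sqrt (1 - 12 * |β'|)) := mul_le_mul_of_nonneg_left hsq (Real.exp_pos _).le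
    _ = 33 * ((R : ℝ) + T) * Real.sqrt ((L : ℝ) ^ 3 / (B.card : ℝ)) * Real.exp (-(1 - 12 * |β'|) * u) / Real.sqrt (1 - 12 * |β'|) := by ring

/-- ★★ **Cold-start equilibration of a block-averaged Wilson loop from log-Sobolev(`ρ`)** (every `β'`, `R + T > 0`, `B` nonempty):
`|E W̄_B(U_(2+u)) − ∫ W̄_B dμ_(β')| ≤ e^(−2ρu) · √(32(R+T)²·(366|β'|L³ + 3 log(3/2) L³ + log 2)/(#B·2ρ))`. [cite: BakryGentilLedoux2014, Thm 5.2.1] -/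
theorem wilson_coldStart_blockLoop_le_exp_of_logSobolev (L : ℕ) [NeZero L] (β' : ℝ) {ρ : ℝ} (hρ : 0 < ρ) (i j : Fin 3) (R T : ℕ) (hRT : 0 < R + T)
    (B : Finset (Site 3 L)) (hB : B.Nonempty) (z : (GaugeConfig 3 L (Matrix.specialUnitaryGroup (Fin 2) ℂ)))
    (hLSgen : ∀ (f : (Edge 3 L × Fin 2 × Fin 2 × Bool → ℝ) → ℝ), ContDiff ℝ 3 f →
        let coords : GaugeConfig 3 L (Matrix.specialUnitaryGroup (Fin 2) ℂ) → (Edge 3 L × Fin 2 × Fin 2 × Bool → ℝ) :=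
          fun V q => (fun z : ℂ => if q.2.2.2 then z.im else z.re)
            ((fundamentalRep (Fin 2) (V q.1) : Matrix (Fin 2) (Fin 2) ℂ) q.2.1 q.2.2.1)
        let gen : GaugeConfig 3 L (Matrix.specialUnitaryGroup (Fin 2) ℂ) → ℝ := fun V =>
          (∑ i : Edge 3 L × Fin 2 × Fin 2 × Bool, fderiv ℝ f (coords V) (Pi.single i 1) *
              (fun z : ℂ => if i.2.2.2 then z.im else z.re)
                ((latticeLangevinDynamics (fundamentalLatticeRep 2) β').drift
                  (matrixConfig (fundamentalRep (Fin 2)) V) i.1 i.2.1 i.2.2.1) +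
          1 / 2 * ∑ i : Edge 3 L × Fin 2 × Fin 2 × Bool, ∑ j : Edge 3 L × Fin 2 × Fin 2 × Bool,
            fderiv ℝ (fun z => fderiv ℝ f z (Pi.single i 1)) (coords V) (Pi.single j 1) *
              ∑ n : Edge 3 L × NoiseIdx 2,
                (if n.1 = i.1 then (fun z : ℂ => if i.2.2.2 then z.im else z.re)
                  ((latticeLangevinDynamics (fundamentalLatticeRep 2) β').noise
                    (matrixConfig (fundamentalRep (Fin 2)) V) i.1 n.2 i.2.1 i.2.2.1) else 0) *
                (if n.1 = j.1 then (fun z : ℂ => if j.2.2.2 then z.im else z.re)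
                  ((latticeLangevinDynamics (fundamentalLatticeRep 2) β').noise
                    (matrixConfig (fundamentalRep (Fin 2)) V) j.1 n.2 j.2.1 j.2.2.1) else 0))
        ρ * ((∫ V, f (coords V) ^ 2 * Real.log (f (coords V) ^ 2) ∂(wilsonMeasure (d := 3) (L := L) (fundamentalRep (Fin 2)) β')) -
            (∫ V, f (coords V) ^ 2 ∂(wilsonMeasure (d := 3) (L := L) (fundamentalRep (Fin 2)) β')) *
              Real.log (∫ V, f (coords V) ^ 2 ∂(wilsonMeasure (d := 3) (L := L) (fundamentalRep (Fin 2)) β'))) ≤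
          -∫ V, f (coords V) * gen V ∂(wilsonMeasure (d := 3) (L := L) (fundamentalRep (Fin 2)) β'))
    {Ω : Type} [MeasurableSpace Ω] {P : Measure Ω} [IsProbabilityMeasure P]
    {W : ℝ≥0 → Ω → (Edge 3 L × NoiseIdx 2 → ℝ)} (hW : IsFlatBrownian W P)
    {U : ℝ≥0 → Ω → (GaugeConfig 3 L (Matrix.specialUnitaryGroup (Fin 2) ℂ))} (hU0 : ∀ ω, U 0 ω = z)
    (hU : (latticeLangevinDynamics (fundamentalLatticeRep 2) β').IsSolution (fundamentalRep (Fin 2)) hW.natFiltration P W U)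
    (u : ℝ≥0) :
    |(∫ ω, (((B.card : ℝ))⁻¹ * ∑ x ∈ B, wilsonLoop (fundamentalRep (Fin 2)) x i j R T (U ((2 : ℝ≥0) + u) ω)) ∂P) - ∫ V, (((B.card : ℝ))⁻¹ * ∑ x ∈ B, wilsonLoop (fundamentalRep (Fin 2)) x i j R T V) ∂(wilsonMeasure (d := 3) (L := L) (fundamentalRep (Fin 2)) β')| ≤
      Real.exp (-(2 * ρ) * u) * Real.sqrt (32 * ((R : ℝ) + T) ^ 2 * (366 * |β'| * (L : ℝ) ^ 3 + 3 * Real.log (3 / 2) * (L : ℝ) ^ 3 + Real.log 2) / ((B.card : ℝ) * (2 * ρ))) := by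
  classical
  haveI := secondCountableTopology_su2
  haveI := borelSpace_config L
  set μ : Measure (GaugeConfig 3 L (Matrix.specialUnitaryGroup (Fin 2) ℂ)) := (wilsonMeasure (d := 3) (L := L) (fundamentalRep (Fin 2)) β') with hμ
  haveI : IsProbabilityMeasure μ :=
    isProbabilityMeasure_wilsonMeasure (d := 3) (L := L) (fundamentalRep (Fin 2)) (continuous_fundamentalRep (Fin 2)) β'
  have hdivpos : 0 < (2 * ρ) := by positivity
  have hS : (0 : ℝ) < (B.card : ℝ) := by exact_mod_cast hB.card_pos
  have hRT' : (0 : ℝ) < (R : ℝ) + T := by exact_mod_cast hRT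
  set co : (GaugeConfig 3 L (Matrix.specialUnitaryGroup (Fin 2) ℂ)) → (Edge 3 L × Fin 2 × Fin 2 × Bool → ℝ) := (fun (V : GaugeConfig 3 L (Matrix.specialUnitaryGroup (Fin 2) ℂ)) (q : Edge 3 L × Fin 2 × Fin 2 × Bool) => (fun z : ℂ => if q.2.2.2 then z.im else z.re) ((fundamentalRep (Fin 2) (V q.1) : Matrix (Fin 2) (Fin 2) ℂ) q.2.1 q.2.2.1)) with hco
  set fp : (Edge 3 L × Fin 2 × Fin 2 × Bool → ℝ) → ℝ := (fun y : (Edge 3 L × Fin 2 × Fin 2 × Bool → ℝ) => (2 * (B.card : ℝ))⁻¹ * ∑ x ∈ B, ((((((List.range R).map (fun m : ℕ => ((Pi.single i ((m : ℕ) : ZMod L) : Site 3 L), i, false)) ++ (List.range T).map (fun m : ℕ => ((Pi.single i ((R : ℕ) : ZMod L) : Site 3 L) + (Pi.single j ((m : ℕ) : ZMod L) : Site 3 L), j, false)) ++ ((List.range R).map (fun m : ℕ => ((Pi.single j ((T : ℕ) : ZMod L) : Site 3 L) + (Pi.single i ((m : ℕ) : ZMod L) : Site 3 L), i, true))).reverse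 ++ ((List.range T).map (fun m : ℕ => ((Pi.single j ((m : ℕ) : ZMod L) : Site 3 L), j, true))).reverse).map (fun q : Site 3 L × Fin 3 × Bool => ((x + q.1, q.2.1), q.2.2))).map (fun a : Edge 3 L × Bool => if a.2 then ((fun (ee : Edge 3 L) => Matrix.of fun (i j : Fin 2) => ((y (ee, i, j, false) : ℝ) : ℂ) + ((y (ee, i, j, true) : ℝ) : ℂ) * Complex.I) a.1)ᴴ else (fun (ee : Edge 3 L) => Matrix.of fun (i j : Fin 2) => ((y (ee, i, j, false) : ℝ) : ℂ) + ((y (ee, i, j, true) : ℝ) : ℂ) * Complex.I) a.1)).prod)).trace.re) with hfp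
  have hfpC : ContDiff ℝ 3 fp := contDiff_blockLoopAverage _ _ B
  have hval : ∀ VV : (GaugeConfig 3 L (Matrix.specialUnitaryGroup (Fin 2) ℂ)), fp (co VV) = (((B.card : ℝ))⁻¹ * ∑ x ∈ B, wilsonLoop (fundamentalRep (Fin 2)) x i j R T VV) := fun VV => blockLoopAverage_coords_eq VV i j R T B hB
  have hlen : (((((List.range R).map (fun m : ℕ => ((Pi.single i ((m : ℕ) : ZMod L) : Site 3 L), i, false)) ++ (List.range T).map (fun m : ℕ => ((Pi.single i ((R : ℕ) : ZMod L) : Site 3 L) + (Pi.single j ((m : ℕ) : ZMod L) : Site 3 L), j, false)) ++ ((List.range R).map (fun m : ℕ => ((Pi.single j ((T : ℕ) : ZMod L) : Site 3 L) + (Pi.single i ((m : ℕ) : ZMod L) : Site 3 L), i, true))).reverse ++ ((List.range T).map (fun m : ℕ => ((Pi.single j ((m : ℕ) : ZMod L) : Site 3 L), j, true))).reverse)).length : ℕ) : ℝ) = 2 * ((R : ℝ) + T) := by rw [rectShape_length]; push_cast; ring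
  have hs : 0 < 32 * ((2 * (B.card : ℝ))⁻¹) ^ 2 * (((((List.range R).map (fun m : ℕ => ((Pi.single i ((m : ℕ) : ZMod L) : Site 3 L), i, false)) ++ (List.range T).map (fun m : ℕ => ((Pi.single i ((R : ℕ) : ZMod L) : Site 3 L) + (Pi.single j ((m : ℕ) : ZMod L) : Site 3 L), j, false)) ++ ((List.range R).map (fun m : ℕ => ((Pi.single j ((T : ℕ) : ZMod L) : Site 3 L) + (Pi.single i ((m : ℕ) : ZMod L) : Site 3 L), i, true))).reverse ++ ((List.range T).map (fun m : ℕ => ((Pi.single j ((m : ℕ) : ZMod L) : Site 3 L), j, true))).reverse)).length : ℕ) : ℝ) ^ 2 * (B.card : ℝ) := by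
    have h2B : 0 < ((2 * (B.card : ℝ))⁻¹) ^ 2 := pow_pos (inv_pos.2 (mul_pos two_pos hS)) 2
    rw [hlen]
    exact mul_pos (mul_pos (mul_pos (by norm_num) h2B) (by positivity)) hS
  have hmain : |(∫ ω, fp (co (U ((2 : ℝ≥0) + u) ω)) ∂P) - ∫ V, fp (co V) ∂μ| ≤
      Real.exp (-(2 * ρ) * u) * Real.sqrt ((32 * ((2 * (B.card : ℝ))⁻¹) ^ 2 * (((((List.range R).map (fun m : ℕ => ((Pi.single i ((m : ℕ) : ZMod L) : Site 3 L), i, false)) ++ (List.range T).map (fun m : ℕ => ((Pi.single i ((R : ℕ) : ZMod L) : Site 3 L) + (Pi.single j ((m : ℕ) : ZMod L) : Site 3 L), j, false)) ++ ((List.range R).map (fun m : ℕ => ((Pi.single j ((T : ℕ) : ZMod L) : Site 3 L) + (Pi.single i ((m : ℕ) : ZMod L) : Site 3 L), i, true))).reverse ++ ((List.range T).map (fun m : ℕ => ((Pi.single j ((m : ℕ) : ZMod L) : Site 3 L), j, true))).reverse)).length : ℕ) : ℝ) ^ 2 * (B.card : ℝ)) * (366 * |β'| * (L : ℝ) ^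 3 + 3 * Real.log (3 / 2) * (L : ℝ) ^ 3 + Real.log 2) / (2 * ρ)) :=
    wilson_coldStart_smooth_le_exp_of_logSobolev_explicit L β' fp hρ hfpC hs hLSgen hW z hU0 hU u (wilson_blockLoopAverage_carre_le L β' _ _ B)
  have hEP : ∫ ω, fp (co (U ((2 : ℝ≥0) + u) ω)) ∂P = ∫ ω, (((B.card : ℝ))⁻¹ * ∑ x ∈ B, wilsonLoop (fundamentalRep (Fin 2)) x i j R T (U ((2 : ℝ≥0) + u) ω)) ∂P :=
    integral_congr_ae (ae_of_all _ fun ω => by beta_reduce; rw [hval])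
  have hEμ : ∫ V, fp (co V) ∂μ = ∫ V, (((B.card : ℝ))⁻¹ * ∑ x ∈ B, wilsonLoop (fundamentalRep (Fin 2)) x i j R T V) ∂μ :=
    integral_congr_ae (ae_of_all _ fun V => by beta_reduce; rw [hval])
  have hS0 : (B.card : ℝ) ≠ 0 := hS.ne'
  have e2 : (32 * ((2 * (B.card : ℝ))⁻¹) ^ 2 * (((((List.range R).map (fun m : ℕ => ((Pi.single i ((m : ℕ) : ZMod L) : Site 3 L), i, false)) ++ (List.range T).map (fun m : ℕ => ((Pi.single i ((R : ℕ) : ZMod L) : Site 3 L) + (Pi.single j ((m : ℕ) : ZMod L) : Site 3 L), j, false)) ++ ((List.range R).map (fun m : ℕ => ((Pi.single j ((T : ℕ) : ZMod L) : Site 3 L) + (Pi.single i ((m : ℕ) : ZMod L) : Site 3 L), i, true))).reverse ++ ((List.range T).map (fun m : ℕ => ((Pi.single j ((m : ℕ) : ZMod L) : Site 3 L), j, true))).reverse)).length : ℕ) : ℝ) ^ 2 * (B.card : ℝ)) * (366 * |β'| * (L : ℝ) ^ 3 + 3 * Real.log (3 / 2) * (L : ℝ) ^ 3 + Real.log 2)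 / (2 * ρ) =
      32 * ((R : ℝ) + T) ^ 2 * (366 * |β'| * (L : ℝ) ^ 3 + 3 * Real.log (3 / 2) * (L : ℝ) ^ 3 + Real.log 2) / ((B.card : ℝ) * (2 * ρ)) := by
    rw [hlen]
    field_simp
  rw [hEP, hEμ, e2] at hmain
  exact hmain

/-- ★★ **Block form from log-Sobolev(`ρ`)**: `|E W̄_B(U_(2+u)) − ∫ W̄_B dμ_(β')| ≤ e^(−2ρu)·(R+T)·√(16(366|β'| + 3)(L³/#B)/ρ)` — only `β'`, `ρ`
and the NUMBER OF BLOCKS `L³/#B` remain (at the route's cut-offs with unit physical blocks, `L_K³/#B_K` is the fixed physical volume).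
[cite: BakryGentilLedoux2014, Thm 5.2.1] -/
theorem wilson_coldStart_blockLoop_le_blocks_of_logSobolev (L : ℕ) [NeZero L] (β' : ℝ) (i j : Fin 3) {ρ : ℝ} (hρ : 0 < ρ) (R T : ℕ) (hRT : 0 < R + T)
    (B : Finset (Site 3 L)) (hB : B.Nonempty) (z : (GaugeConfig 3 L (Matrix.specialUnitaryGroup (Fin 2) ℂ)))
    (hLSgen : ∀ (f : (Edge 3 L × Fin 2 × Fin 2 × Bool → ℝ) → ℝ), ContDiff ℝ 3 f →
        let coords : GaugeConfig 3 L (Matrix.specialUnitaryGroup (Fin 2) ℂ) → (Edge 3 L × Fin 2 × Fin 2 × Bool → ℝ) :=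
          fun V q => (fun z : ℂ => if q.2.2.2 then z.im else z.re)
            ((fundamentalRep (Fin 2) (V q.1) : Matrix (Fin 2) (Fin 2) ℂ) q.2.1 q.2.2.1)
        let gen : GaugeConfig 3 L (Matrix.specialUnitaryGroup (Fin 2) ℂ) → ℝ := fun V =>
          (∑ i : Edge 3 L × Fin 2 × Fin 2 × Bool, fderiv ℝ f (coords V) (Pi.single i 1) *
              (fun z : ℂ => if i.2.2.2 then z.im else z.re)
                ((latticeLangevinDynamics (fundamentalLatticeRep 2) β').drift
                  (matrixConfig (fundamentalRep (Fin 2)) V) i.1 i.2.1 i.2.2.1) +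
          1 / 2 * ∑ i : Edge 3 L × Fin 2 × Fin 2 × Bool, ∑ j : Edge 3 L × Fin 2 × Fin 2 × Bool,
            fderiv ℝ (fun z => fderiv ℝ f z (Pi.single i 1)) (coords V) (Pi.single j 1) *
              ∑ n : Edge 3 L × NoiseIdx 2,
                (if n.1 = i.1 then (fun z : ℂ => if i.2.2.2 then z.im else z.re)
                  ((latticeLangevinDynamics (fundamentalLatticeRep 2) β').noise
                    (matrixConfig (fundamentalRep (Fin 2)) V) i.1 n.2 i.2.1 i.2.2.1) else 0) *
                (if n.1 = j.1 then (fun z : ℂ => if j.2.2.2 then z.im else z.re)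
                  ((latticeLangevinDynamics (fundamentalLatticeRep 2) β').noise
                    (matrixConfig (fundamentalRep (Fin 2)) V) j.1 n.2 j.2.1 j.2.2.1) else 0))
        ρ * ((∫ V, f (coords V) ^ 2 * Real.log (f (coords V) ^ 2) ∂(wilsonMeasure (d := 3) (L := L) (fundamentalRep (Fin 2)) β')) -
            (∫ V, f (coords V) ^ 2 ∂(wilsonMeasure (d := 3) (L := L) (fundamentalRep (Fin 2)) β')) *
              Real.log (∫ V, f (coords V) ^ 2 ∂(wilsonMeasure (d := 3) (L := L) (fundamentalRep (Fin 2)) β'))) ≤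
          -∫ V, f (coords V) * gen V ∂(wilsonMeasure (d := 3) (L := L) (fundamentalRep (Fin 2)) β'))
    {Ω : Type} [MeasurableSpace Ω] {P : Measure Ω} [IsProbabilityMeasure P]
    {W : ℝ≥0 → Ω → (Edge 3 L × NoiseIdx 2 → ℝ)} (hW : IsFlatBrownian W P)
    {U : ℝ≥0 → Ω → (GaugeConfig 3 L (Matrix.specialUnitaryGroup (Fin 2) ℂ))} (hU0 : ∀ ω, U 0 ω = z)
    (hU : (latticeLangevinDynamics (fundamentalLatticeRep 2) β').IsSolution (fundamentalRep (Fin 2)) hW.natFiltration P W U)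
    (u : ℝ≥0) :
    |(∫ ω, (((B.card : ℝ))⁻¹ * ∑ x ∈ B, wilsonLoop (fundamentalRep (Fin 2)) x i j R T (U ((2 : ℝ≥0) + u) ω)) ∂P) - ∫ V, (((B.card : ℝ))⁻¹ * ∑ x ∈ B, wilsonLoop (fundamentalRep (Fin 2)) x i j R T V) ∂(wilsonMeasure (d := 3) (L := L) (fundamentalRep (Fin 2)) β')| ≤
      Real.exp (-(2 * ρ) * u) * (((R : ℝ) + T) * Real.sqrt (16 * (366 * |β'| + 3) * ((L : ℝ) ^ 3 / (B.card : ℝ)) / ρ)) := by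
  have h2ρ : 0 < 2 * ρ := by positivity
  have hRT' : (0 : ℝ) < (R : ℝ) + T := by exact_mod_cast hRT
  have hS : (0 : ℝ) < (B.card : ℝ) := by exact_mod_cast hB.card_pos
  have h := wilson_coldStart_blockLoop_le_exp_of_logSobolev L β' hρ i j R T hRT B hB z hLSgen hW hU0 hU u
  refine h.trans (mul_le_mul_of_nonneg_left ?_ (Real.exp_pos _).le)
  have hL1 : (1 : ℝ) ≤ (L : ℝ) := by exact_mod_cast Nat.one_le_iff_ne_zero.2 (NeZero.ne L)
  have hL3 : (1 : ℝ) ≤ (L : ℝ) ^ 3 := one_le_pow₀ hL1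
  have hL30 : (0 : ℝ) < (L : ℝ) ^ 3 := by positivity
  have h32 : Real.log (3 / 2 : ℝ) ≤ 1 / 2 := by
    have := Real.log_le_sub_one_of_pos (by norm_num : (0 : ℝ) < 3 / 2); linarith
  have h2 : Real.log (2 : ℝ) ≤ 1 := by
    have := Real.log_le_sub_one_of_pos (by norm_num : (0 : ℝ) < 2); linarith
  have hBL : (366 * |β'| * (L : ℝ) ^ 3 + 3 * Real.log (3 / 2) * (L : ℝ) ^ 3 + Real.log 2) ≤ (366 * |β'| + 3) * (L : ℝ) ^ 3 := by
    nlinarith [mul_le_mul_of_nonneg_right h32 hL30.le, abs_nonneg β']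
  have hq : 32 * ((R : ℝ) + T) ^ 2 * (366 * |β'| * (L : ℝ) ^ 3 + 3 * Real.log (3 / 2) * (L : ℝ) ^ 3 + Real.log 2) / ((B.card : ℝ) * (2 * ρ)) ≤ (((R : ℝ) + T) * Real.sqrt (16 * (366 * |β'| + 3) * ((L : ℝ) ^ 3 / (B.card : ℝ)) / ρ)) ^ 2 := by
    rw [mul_pow, Real.sq_sqrt (by positivity)]
    rw [div_le_iff₀ (mul_pos hS h2ρ)]
    have hS0 : (B.card : ℝ) ≠ 0 := hS.ne'
    have hρ0 : ρ ≠ 0 := hρ.ne'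
    have e : ((R : ℝ) + T) ^ 2 * (16 * (366 * |β'| + 3) * ((L : ℝ) ^ 3 / (B.card : ℝ)) / ρ) * ((B.card : ℝ) * (2 * ρ)) = 32 * ((R : ℝ) + T) ^ 2 * ((366 * |β'| + 3) * (L : ℝ) ^ 3) := by
      field_simp
      ring
    rw [e]
    exact mul_le_mul_of_nonneg_left hBL (by positivity)
  exact (Real.sqrt_le_sqrt hq).trans (le_of_eq (Real.sqrt_sq (by positivity)))

end Summit.QuantumFields.YangMills.Theorems.ColdStartUniversality
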